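import Literature.Probability.RandomPlanarGeometry.HexParafermionProofs
import HarnessLib

/-!
# Winding constancy at a target adjacent to the source (stub `stub_adjacentWinding` of line `Sketch`)

Crux `stmt-CriticalPhenomena-16769` (`Summit.CriticalPhenomena.SAWScalingLimit.Theses.SAWSpinMonotone.SpinMonotone`, route
`SAWSpinMonotone`), line `Sketch` (skeleton `Cruxes/SpinMonotone/Lines/Sketch.lean`), registered stub `stub_adjacentWinding`.

For a simply connected hexagonal domain `Λ`, a boundary mid-edge `a = {u, w₁}` (`u ∉ Λ ∋ w₁`) and a target `v ∈ Λ` ADJACENT to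
the source vertex `w₁`, with `p, q` the other two neighbours of `v` and `q` the FAR port (reached from `u` by a lattice `3`-path
avoiding `w₁`), every self-avoiding walk of `Λ ∖ v` from `a` to the mid-edge `{v, w₁}` / `{v, p}` / `{v, q}` has winding
`ε·π/3` / `ε·π` / `ε·5π/3`, where `ε = ±1` is the turn `u → w₁ → v`.

Proof (Duminil-Copin–Smirnov's remark "we used the fact that `a` is on the boundary and `Ω` is simply connected", made
quantitative): in the coordinate chart `Φ` of `HexParafermionTransport.exists_chart` (entrance `wOut → O`), the winding of a
walk is `(π/3)·pturn` of its code (`winding_eq_pturn_code`, the transport step of `HexMidEdgeSAW.weight_eq_pwt`); closing the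
code `wOut, O, x₁, …, t', (v')` of a first arrival through the target `v' = Φ v ∼ O` gives a simple cycle of `Φ(Λ)`, which has
winding number `0` around the entrance face by simple connectivity (`HV.wnd_eq_zero_of_simplyConnected`), so the loop lemma
`HV.cturn_eq_neg_six_mul_turn` computes its turning number; bookkeeping of the turns at `O` and at `v'` gives
`pturn = 4·turn(wOut,O,v') − turn(t',v',O)` (`pturn_adjacent_code`), and the last turn is `∓turn(wOut,O,v')` according as the
port is far / mid (`farPort_turn`, a finite check at the standard entrance).
-/

noncomputable section

namespace Summit.CriticalPhenomena.SAWScalingLimit.Cruxes.SpinMonotone.AdjacentPort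

open Literature.Probability.LatticeModels
open Literature.Probability.RandomPlanarGeometry Literature.Probability.RandomPlanarGeometry.SAW
open Literature.Probability.RandomPlanarGeometry.SAW.HV

/-! ## A. Transport: the winding of a walk is `(π/3)·pturn` of its code -/

section Transport

variable {Λ : Finset HexVertex} {a : Sym2 HexVertex} {u w₁ v t : HexVertex} {Φ : hexGraph ≃g hvGraph} {α β : ℂ}

/-- **The geometric winding of a nontrivial walk between mid-edges is `(π/3)·pturn` of its code** (any spin: this is the
transport step `hW` of `HexMidEdgeSAW.weight_eq_pwt` — the chart is a similarity, half-edges at the ends do not turn, lattice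
turns are `±π/3`). [cite: DuminilCopinSmirnov2012, §2 (winding = total rotation of the direction)] -/
theorem winding_eq_pturn_code (γ : HexMidEdgeSAW Λ a s(v, t)) (ha : a = s(u, w₁)) (hu : u ∉ Λ) (hΦu : Φ u = wOut)
    (hΦw : Φ w₁ = hvOrigin) (hvt : hexGraph.Adj v t) (haff : ∀ f, emb (pos (Φ f)) = α * hexCenter f + β) (hα : α ≠ 0)
    (hne : γ.verts ≠ []) {e : HexVertex}
    (he : (γ.verts.getLast hne = v ∧ e = t) ∨ (γ.verts.getLast hne = t ∧ e = v)) :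
    γ.winding = (Real.pi / 3) * (pturn (wOut :: (γ.verts.map Φ ++ [Φ e])) : ℝ) := by
  have hmw := γ.isMidWalk_code Φ ha hu hΦu hΦw hvt hne he
  set m := γ.verts.map Φ with hm
  have hmne : m ≠ [] := by simpa [hm] using hne
  have hcode : wOut :: (m ++ [Φ e]) = (u :: (γ.verts ++ [e])).map Φ := by simp [hm, hΦu]
  have hc : ∀ f, hexCenter f = α⁻¹ * emb (pos (Φ f)) + -(β / α) := by
    intro f; rw [haff]; field_simp; ring
  rw [γ.winding_eq_winding_map ha hu hne he]
  have e1 : (u :: (γ.verts ++ [e])).map hexCenter =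
      (((u :: (γ.verts ++ [e])).map Φ).map fun y => emb (pos y)).map fun z => α⁻¹ * z + -(β / α) := by
    simp only [List.map_map]
    exact List.map_congr_left fun f _ => hc f
  rw [e1, winding_map_affine (inv_ne_zero hα), ← hcode]
  refine winding_map_emb_pos _ hmw.1 ?_
  have hQ : (wOut :: m).Nodup := by
    refine List.nodup_cons.2 ⟨fun h => hu ?_, γ.nodup.map Φ.injective⟩
    rw [hm, ← hΦu, List.mem_map] at h
    obtain ⟨y, hy, hyu⟩ := h
    exact Φ.injective hyu ▸ γ.subset y hy
  have hnb : ∀ (i : ℕ) (hi : i + 2 < ((wOut :: m) ++ [Φ e]).length),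
      ((wOut :: m) ++ [Φ e])[i] ≠ ((wOut :: m) ++ [Φ e])[i + 2] := by
    intro i hi
    by_cases h2 : i + 2 < (wOut :: m).length
    · rw [List.getElem_append_left (by omega), List.getElem_append_left h2]
      intro h
      have := (hQ.getElem_inj_iff).1 h
      omega
    · have hlen : i + 2 = (wOut :: m).length := by
        simp only [List.length_append, List.length_singleton] at hi
        omega
      rw [List.getElem_append_left (by omega), List.getElem_concat_length hlen,
        ← prevOf_eq_getElem_cons hmne (by omega) (by simp at hlen; omega)]
      exact (γ.map_ne_prevOf ha hu hΦu hne he).symm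
  exact hnb

end Transport

/-! ## B. The far-port turn at the standard entrance (finite check) -/

/-- **Far-port turn**: at the standard entrance `wOut → O`, for a target `v' ∼ O` (`v' ≠ wOut`) and a neighbour `q' ≠ O` of `v'`
reached from `wOut` by a `3`-path `wOut → x → y → q'` with `x ≠ O`, the turn `q' → v' → O` is opposite to the turn
`wOut → O → v'` (the walk `wOut → O → v' → q'` keeps turning in one sense). [folklore] -/
theorem farPort_turn (v' q' x y : HV) (hv : hvGraph.Adj hvOrigin v') (hvw : v' ≠ wOut) (hq : hvGraph.Adj v' q')
    (hqO : q' ≠ hvOrigin) (hxO : x ≠ hvOrigin) (hx : hvGraph.Adj wOut x) (hxy : hvGraph.Adj x y) (hyq : hvGraph.Adj y q') :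
    turn q' v' hvOrigin = -turn wOut hvOrigin v' := by
  obtain ⟨a, b, c⟩ := v'
  obtain ⟨a₁, b₁, c₁⟩ := q'
  obtain ⟨a₂, b₂, c₂⟩ := x
  obtain ⟨a₃, b₃, c₃⟩ := y
  simp only [hvOrigin, wOut, hvGraph_adj, HV.AdjRel, ne_eq, Prod.mk.injEq] at hv hvw hq hqO hxO hx hxy hyq
  cases c <;> cases c₁ <;> cases c₂ <;> cases c₃ <;> simp at hv hvw hq hqO hxO hx hxy hyq
  rcases hv with ⟨rfl, rfl⟩ | ⟨rfl, rfl⟩ | ⟨rfl, rfl⟩ <;>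
    rcases hq with ⟨rfl, rfl⟩ | ⟨rfl, rfl⟩ | ⟨rfl, rfl⟩ <;>
    rcases hx with ⟨rfl, rfl⟩ | ⟨rfl, rfl⟩ | ⟨rfl, rfl⟩ <;>
    rcases hxy with ⟨rfl, rfl⟩ | ⟨rfl, rfl⟩ | ⟨rfl, rfl⟩ <;>
    first | (exfalso; omega) | decide

/-! ## C. The loop-lemma core: `pturn` of a first-arrival code closed through the adjacent target -/

/-- `leftFace O wOut` is the entrance face `(1, 0)`. [folklore] -/
theorem leftFace_hvOrigin_wOut : leftFace hvOrigin wOut = (1, 0) := by decide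

/-- **`pturn` of a first-arrival code at a target adjacent to the source.** Let `M = [x₁, …, t'] ≠ []` and suppose that
`O :: M ++ [v']` is a simple cycle (so `O ∼ x₁`, `t' ∼ v'`, `v' ∼ O`) avoiding `wOut` and with winding number `0` around the
entrance face `(1, 0)`. Then `pturn (wOut :: O :: M ++ [v']) = 4·turn(wOut, O, v') − turn(t', v', O)`: the loop lemma gives
`cturn = −6·turn(wOut, O, x₁)`, and at `O` the turns towards `x₁` and towards `v'` are opposite.
[cite: DuminilCopinSmirnov2012, proof of Lemma 1 ("we used the fact that a is on the boundary and Ω is simply connected")] -/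
theorem pturn_adjacent_code (M : List HV) (v' : HV) (hM : M ≠ []) (hcyc : IsCyc (hvOrigin :: (M ++ [v'])))
    (hwM : wOut ∉ M) (hv'w : v' ≠ wOut) (h0 : wnd (hvOrigin :: (M ++ [v'])) (1, 0) = 0) :
    pturn (wOut :: hvOrigin :: (M ++ [v'])) = 4 * turn wOut hvOrigin v' - turn (M.getLast hM) v' hvOrigin := by
  obtain ⟨x₁, M', rfl⟩ := List.exists_cons_of_ne_nil hM
  set t' := (x₁ :: M').getLast hM with ht'
  have hL : (x₁ :: M') ++ [v'] ≠ [] := by simp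
  -- anatomy of the cycle
  have hnd := hcyc.2.1
  have hadj := hcyc.2.2
  have hlast : (hvOrigin :: ((x₁ :: M') ++ [v'])).getLast (List.cons_ne_nil _ _) = v' := by simp
  have hOv' : hvGraph.Adj v' hvOrigin := by
    have hmem : (v', hvOrigin) ∈ cdarts (hvOrigin :: ((x₁ :: M') ++ [v'])) := by
      rw [cdarts_eq (List.cons_ne_nil _ _), List.mem_append, List.mem_singleton]
      right; simp
    exact hadj _ hmem
  have hOx₁ : hvGraph.Adj hvOrigin x₁ := by
    have hmem : (hvOrigin, x₁) ∈ cdarts (hvOrigin :: ((x₁ :: M') ++ [v'])) := by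
      rw [cdarts_eq (List.cons_ne_nil _ _), List.cons_append, pdarts_cons_cons]
      exact List.mem_append_left _ List.mem_cons_self
    exact hadj _ hmem
  have hx₁w : x₁ ≠ wOut := fun h => hwM (h ▸ List.mem_cons_self)
  have hv'M : v' ∉ x₁ :: M' := by
    have h1 : ((x₁ :: M') ++ [v']).Nodup := (List.nodup_cons.1 hnd).2
    exact (List.nodup_append.1 h1).2.2 |> fun h hm => h _ hm _ (List.mem_singleton_self _) rfl
  have hx₁v' : x₁ ≠ v' := fun h => hv'M (h ▸ List.mem_cons_self)
  -- the loop lemma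
  have hsn : wOut ∉ hvOrigin :: ((x₁ :: M') ++ [v']) := by
    intro h
    rw [List.mem_cons, List.mem_append, List.mem_singleton] at h
    rcases h with h | h | h
    · exact absurd h (by decide)
    · exact hwM h
    · exact hv'w h.symm
  have h0' : wnd (hvOrigin :: ((x₁ :: M') ++ [v'])) (leftFace hvOrigin wOut) = 0 := by
    rw [leftFace_hvOrigin_wOut]; exact h0
  have hct := cturn_eq_neg_six_mul_turn hcyc hL adj_wOut_hvOrigin.symm hsn h0'
  have hhead : ((x₁ :: M') ++ [v']).head hL = x₁ := rfl
  rw [hhead] at hct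
  set τ := turn wOut hvOrigin x₁ with hτ
  -- turns at `O`
  have t1 : turn v' hvOrigin x₁ = -τ :=
    turn_eq_neg_turn adj_wOut_hvOrigin.symm hOx₁ hOv'.symm hx₁w.symm hx₁v' hv'w.symm
  have t2 : turn wOut hvOrigin v' = -τ :=
    turn_eq_neg_turn' adj_wOut_hvOrigin.symm hOx₁ hOv'.symm hx₁w.symm hx₁v' hv'w.symm
  -- splitting the turn sums
  have e1 : pturn (wOut :: hvOrigin :: ((x₁ :: M') ++ [v'])) =
      τ + pturn (hvOrigin :: ((x₁ :: M') ++ [v'])) := rfl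
  have e2 : cturn (hvOrigin :: ((x₁ :: M') ++ [v'])) =
      pturn (hvOrigin :: ((x₁ :: M') ++ [v'])) + turn t' v' hvOrigin + turn v' hvOrigin x₁ := by
    rw [cturn, show (hvOrigin :: ((x₁ :: M') ++ [v'])).take 2 = [hvOrigin, x₁] from rfl,
      pturn_concat_turn _ (List.cons_ne_nil _ _) hvOrigin x₁, hlast]
    have e3 : hvOrigin :: ((x₁ :: M') ++ [v']) ++ [hvOrigin] = (hvOrigin :: (x₁ :: M')) ++ [v', hvOrigin] := by simp
    have e4 : hvOrigin :: ((x₁ :: M') ++ [v']) = (hvOrigin :: (x₁ :: M')) ++ [v'] := by simp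
    rw [e3, pturn_concat_turn _ (List.cons_ne_nil _ _) v' hvOrigin, ← e4, List.getLast_cons hM]
  rw [e1]
  linarith [hct, e2, t1, t2]

/-! ## D. The stub -/

section Stub

variable {Λ : Finset HexVertex} {u w₁ v : HexVertex}

/-- A walk of `Λ ∖ v` from `{u, w₁}` (`u ∉ Λ`, `w₁ ∼ v`) to a port `{v, t}` of `v` is nontrivial. [folklore] -/
theorem verts_ne_nil_of_port {t : HexVertex} (hu : u ∉ Λ) (hv : v ∈ Λ) (hvw : hexGraph.Adj v w₁)
    (γ : HexMidEdgeSAW (Λ.erase v) s(u, w₁) s(v, t)) : γ.verts ≠ [] := by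
  intro h
  have e := γ.eq_of_nil h
  rcases Sym2.eq_iff.1 e with ⟨rfl, -⟩ | ⟨rfl, rfl⟩
  · exact hu hv
  · exact hvw.ne rfl

/-- Such a walk ends at `t` (the vertex `v` is erased), so the far end of its final mid-edge is `v`. [folklore] -/
theorem getLast_eq_of_port {t : HexVertex} (γ : HexMidEdgeSAW (Λ.erase v) s(u, w₁) s(v, t)) (hne : γ.verts ≠ []) :
    γ.verts.getLast hne = t ∧ v = v := by
  refine ⟨?_, rfl⟩
  rcases γ.getLast_eq_or hne with h | h
  · have hm := List.getLast_mem hne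
    rw [h] at hm
    exact absurd rfl (Finset.mem_erase.1 (γ.subset _ hm)).1
  · exact h

end Stub

/-- **Stub `stub_adjacentWinding` (winding constancy at an adjacent target).** At an adjacent configuration every self-avoiding
walk of `Λ ∖ v` from `{u, w₁}` to the port `{v, w₁}` / `{v, p}` / `{v, q}` (`q` the far port) has winding `ε·π/3` / `ε·π` /
`ε·5π/3` for one sign `ε = ±1` (the turn `u → w₁ → v`). [cite: DuminilCopinSmirnov2012, §2 and proof of Lemma 1] -/
theorem stub_adjacentWinding : ∀ (Λ : Finset HexVertex) (u w₁ v p q : HexVertex),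
    hexDomainSimplyConnected Λ → u ∉ Λ → w₁ ∈ Λ → v ∈ Λ → hexGraph.Adj u w₁ → hexGraph.Adj v w₁ →
    hexGraph.Adj v p → hexGraph.Adj v q → w₁ ≠ p → p ≠ q → w₁ ≠ q →
    (∃ x y : HexVertex, x ≠ w₁ ∧ hexGraph.Adj u x ∧ hexGraph.Adj x y ∧ hexGraph.Adj y q) →
    ∃ ε : ℝ, (ε = 1 ∨ ε = -1) ∧
      (∀ γ : HexMidEdgeSAW (Λ.erase v) s(u, w₁) s(v, w₁), γ.winding = ε * (Real.pi / 3)) ∧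
      (∀ γ : HexMidEdgeSAW (Λ.erase v) s(u, w₁) s(v, p), γ.winding = ε * Real.pi) ∧
      (∀ γ : HexMidEdgeSAW (Λ.erase v) s(u, w₁) s(v, q), γ.winding = ε * (5 * Real.pi / 3)) := by
  intro Λ u w₁ v p q hΛ hu hw₁ hv huw hvw hvp hvq n₁ n₂ n₃ hfar
  obtain ⟨Φ, α, β, hα, hΦu, hΦw, haff⟩ := exists_chart huw
  have hu' : u ∉ Λ.erase v := fun h => hu (Finset.mem_of_mem_erase h)
  -- the target and the ports in the chart
  have hOv : hvGraph.Adj hvOrigin (Φ v) := hΦw ▸ (Φ.map_rel_iff).2 hvw.symm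
  have hvwO : Φ v ≠ wOut := by rw [← hΦu]; exact Φ.injective.ne fun h => hu (h ▸ hv)
  have hvp' : hvGraph.Adj (Φ v) (Φ p) := (Φ.map_rel_iff).2 hvp
  have hvq' : hvGraph.Adj (Φ v) (Φ q) := (Φ.map_rel_iff).2 hvq
  have hpO : Φ p ≠ hvOrigin := by rw [← hΦw]; exact Φ.injective.ne n₁.symm
  have hqO : Φ q ≠ hvOrigin := by rw [← hΦw]; exact Φ.injective.ne n₃.symm
  have hpq' : Φ p ≠ Φ q := Φ.injective.ne n₂
  -- the sign
  set εz : ℤ := turn wOut hvOrigin (Φ v) with hεz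
  have hε : (εz : ℝ) = 1 ∨ (εz : ℝ) = -1 := by
    rcases adj_cases adj_wOut_hvOrigin.symm hOv with h | h | h
    · exact absurd h hvwO
    · right; rw [hεz, h, turn_ccw adj_wOut_hvOrigin.symm]; norm_num
    · left; rw [hεz, h, turn_cw adj_wOut_hvOrigin.symm]; norm_num
  -- the far-port turn and the mid-port turn
  have hfar' : turn (Φ q) (Φ v) hvOrigin = -εz := by
    obtain ⟨x, y, hxw, hux, hxy, hyq⟩ := hfar
    refine farPort_turn (Φ v) (Φ q) (Φ x) (Φ y) hOv hvwO hvq' hqO ?_ ?_ ((Φ.map_rel_iff).2 hxy)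
      ((Φ.map_rel_iff).2 hyq)
    · rw [← hΦw]; exact Φ.injective.ne hxw
    · rw [← hΦu]; exact (Φ.map_rel_iff).2 hux
  have hmid' : turn (Φ p) (Φ v) hvOrigin = εz := by
    have := turn_eq_neg_turn (v := Φ v) hvq' hOv.symm hvp' hqO hpO.symm hpq'.symm
    rw [this, hfar', neg_neg]
  -- the winding of a walk to a port `t ≠ w₁`, via the loop lemma
  have key : ∀ (t : HexVertex) (hvt : hexGraph.Adj v t) (γ : HexMidEdgeSAW (Λ.erase v) s(u, w₁) s(v, t)),
      t ≠ w₁ → γ.winding = (Real.pi / 3) * ((4 * εz - turn (Φ t) (Φ v) hvOrigin : ℤ) : ℝ) := by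
    intro t hvt γ htw
    have hne := verts_ne_nil_of_port hu hv hvw γ
    have hlt := (getLast_eq_of_port γ hne).1
    have he : (γ.verts.getLast hne = v ∧ v = t) ∨ (γ.verts.getLast hne = t ∧ v = v) := Or.inr ⟨hlt, rfl⟩
    rw [winding_eq_pturn_code γ rfl hu' hΦu hΦw hvt haff hα hne he]
    congr 1
    -- the code as `wOut :: O :: M ++ [Φ v]`
    obtain ⟨x, rest, hx⟩ := List.exists_cons_of_ne_nil hne
    have hxw : x = w₁ := by rw [← γ.head_eq rfl hu' hne]; simp [hx]
    rw [hxw] at hx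
    have hrest : rest ≠ [] := by
      rintro rfl
      apply htw
      rw [← hlt]; simp [hx]
    set M := rest.map Φ with hM
    have hMne : M ≠ [] := by simpa [hM] using hrest
    have hcode : wOut :: (γ.verts.map Φ ++ [Φ v]) = wOut :: hvOrigin :: (M ++ [Φ v]) := by
      simp [hx, hM, hΦw]
    have hrl : rest.getLast hrest = t := by
      rw [← hlt]; simp [hx, List.getLast_cons hrest]
    have hMlast : M.getLast hMne = Φ t := by
      simp [hM, List.getLast_map, hrl]
    rw [hcode]
    -- the closed code is a simple cycle of `Φ(Λ)` outside the entrance face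
    have hmw := γ.isMidWalk_code Φ rfl hu' hΦu hΦw hvt hne he
    have hchain : (hvOrigin :: (M ++ [Φ v])).IsChain hvGraph.Adj := by
      have h1 := hmw.1
      rw [hcode] at h1
      exact h1.tail
    have hvΦ : Φ v ∉ γ.verts.map Φ := by
      intro h
      obtain ⟨y, hy, hyv⟩ := List.mem_map.1 h
      exact (Finset.mem_erase.1 (γ.subset y hy)).1 (Φ.injective hyv)
    have hnodup : (hvOrigin :: (M ++ [Φ v])).Nodup := by
      have h1 : (γ.verts.map Φ ++ [Φ v]).Nodup := by
        refine List.nodup_append.2 ⟨γ.nodup.map Φ.injective, List.nodup_singleton _, ?_⟩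
        intro z hz w hw
        rw [List.mem_singleton] at hw
        rintro rfl
        exact hvΦ (hw ▸ hz)
      simpa [hx, hM, hΦw] using h1
    have hcyc : IsCyc (hvOrigin :: (M ++ [Φ v])) := by
      refine ⟨by have := List.length_pos_of_ne_nil hMne; simp; omega, hnodup, fun d hd => ?_⟩
      rw [cdarts_eq (List.cons_ne_nil _ _), List.mem_append, List.mem_singleton] at hd
      rcases hd with hd | rfl
      · exact adj_of_mem_pdarts hchain d hd
      · simp only [List.getLast_cons (by simp : M ++ [Φ v] ≠ []), List.getLast_append_of_ne_nil _ (List.cons_ne_nil _ _),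
          List.getLast_singleton, List.head_cons]
        exact hOv.symm
    have hsub : ∀ z ∈ hvOrigin :: (M ++ [Φ v]), z ∈ Λ.map Φ.toEquiv.toEmbedding := by
      intro z hz
      simp only [List.mem_cons, List.mem_append, List.mem_nil_iff, or_false] at hz
      rcases hz with rfl | hz | rfl
      · exact Finset.mem_map.2 ⟨w₁, hw₁, hΦw⟩
      · obtain ⟨y, hy, rfl⟩ := List.mem_map.1 hz
        exact Finset.mem_map_of_mem _ (Finset.mem_of_mem_erase (γ.subset y (by rw [hx]; exact List.mem_cons_of_mem _ hy)))
      · exact Finset.mem_map_of_mem _ hv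
    have hwM : wOut ∉ M := by
      intro h
      obtain ⟨y, hy, hyu⟩ := List.mem_map.1 h
      rw [← hΦu] at hyu
      exact hu' (Φ.injective hyu ▸ γ.subset y (by rw [hx]; exact List.mem_cons_of_mem _ hy))
    have h0 := wnd_eq_zero_of_simplyConnected hΛ hu hΦu _ hsub hcyc
    rw [pturn_adjacent_code M (Φ v) hMne hcyc hwM hvwO h0, hMlast]
  refine ⟨εz, hε, fun γ => ?_, fun γ => ?_, fun γ => ?_⟩
  · -- the port `{v, w₁}`: the walk is `[w₁]`
    have hne := verts_ne_nil_of_port hu hv hvw γ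
    have hlt := (getLast_eq_of_port γ hne).1
    have he : (γ.verts.getLast hne = v ∧ v = w₁) ∨ (γ.verts.getLast hne = w₁ ∧ v = v) := Or.inr ⟨hlt, rfl⟩
    rw [winding_eq_pturn_code γ rfl hu' hΦu hΦw hvw haff hα hne he]
    have h1 : γ.verts.length = 1 :=
      length_eq_one_of_head_eq_getLast hne γ.nodup ((γ.head_eq rfl hu' hne).trans hlt.symm)
    obtain ⟨x, rest, hx⟩ := List.exists_cons_of_ne_nil hne
    have hrest : rest = [] := by simpa [hx] using h1
    subst hrest
    have hxw : x = w₁ := by rw [← γ.head_eq rfl hu' hne]; simp [hx]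
    rw [hxw] at hx
    simp only [hx, List.map_cons, List.map_nil, List.nil_append, List.cons_append, hΦw, pturn_cons₃, pturn_two, add_zero]
    rw [← hεz]; ring
  · rw [key p hvp γ n₁.symm, hmid']; push_cast; ring
  · rw [key q hvq γ n₃.symm, hfar']; push_cast; ring

end Summit.CriticalPhenomena.SAWScalingLimit.Cruxes.SpinMonotone.AdjacentPort

end
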